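import Summits.QuantumFields.YangMills.Theorems.AlphaInputsT3ACv4SmallFactor71OfRecDL
import Summits.QuantumFields.YangMills.Theorems.AlphaInputsT3ACv4SeamWindow
import Summits.QuantumFields.YangMills.Theorems.AlphaInputsT3ACv4RecordNested
import HarnessLib

/-!
# `AlphaInputsT3ACv4SeamWindowDL` — LF-2 CLOSED BY NAME: THE (71)_sym SEAM ROW FROM ONE `γ₀`-ROW AND THE NESTED v4 DISPLAY'S CLOSERS AT **EVERY ODD `L > 1`** (the `_dL` closure of
# ✓`AlphaInputsT3ACv4SeamWindow` §2–§3 and ✓`AlphaInputsT3ACv4RecordNested` §3–§4: the floor `5 ≤ L` is GONE) — ★★★ `laneRecordsV4Chi_of_thm1In8_nestedDataRows_dL : … → ∀ L, Odd L →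
# 1 < L → AlphaInputsT3ACv4RecChi L` = the v5p10 stub text's shape — cell `ym3-torus`, crux `HistoryTailL` (stmt-QuantumFields-19936), width seat ym-ust-19936-w6 (g2); ★★OWNER
# ym3-torus-plan g26 ACK 36 row «LF-2 CLOSER» = LEAD ★w1-19936 g3 row «v4 RECORD FLOOR-FREE» (one file, as the OWNER ruled)

WHY.  ✓`AlphaInputsT3AC.smallFactor71OfRecT3_of_gamma0 (hL5 : 5 ≤ F.L)` (★alpha-2 g7) folds the three (71) window numerals into one record row on `γ₀` through the
coefficient-generic ✓`AlphaInputsT3AC.windows71_of_gamma0`, but inherits the floor `5 ≤ L` of ✓`smallFactor71OfRecT3_of_windows` (LF-2: `EMLIterUniform.step_dominates`), and so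
do ✓`…v4RecordNested`'s closers `pinnedPartsT3ACRecSelXsV4Chi_of_nested (hL5)`, `alphaInputsT3ACv4RecChi_of_pinnedPartsRecNestedV4Chi (hL5)` and the one-supplier form
`laneRecordsV4Chi_of_thm1In8_nestedDataRows : … → ∀ L, Odd L → 5 ≤ L → AlphaInputsT3ACv4RecChi L`.  ★w2-19936 g4's ✓`AlphaInputsT3AC.smallFactor71OfRecT3_of_windows_dL`
(`…v4SmallFactor71OfRecDL`, over the Duhamel∕`_dL` second order ✓`…UniformLgeD` → ✓`…SymAvgSixtyNineOfExpansion` → ✓`…SymAvgSixtyNineT3DL`) has NO floor, at the price of new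
window coefficients: `36288000·L²·C68·ε₁(j) ≤ 1`, `ε₁(j) ≤ 1`, `½(2C68·C₂′ + C₂′²)·ε₁(j) ≤ ¼` with `C₂′ = (11612160000·L² + 1331529∕4)·C68²`.  THIS FILE:
* §1 feeds those coefficients to `windows71_of_gamma0` (`a := 36288000·L²·C68`, `c := 2C68·C₂′ + C₂′²`): ★ `AlphaInputsT3AC.smallFactor71OfRecT3_of_gamma0_dL` — the seam row
  `SmallFactor71OfRecT3 F 𝔠 γ hγ hγ1 K` at EVERY `(γ, K)` of the record's window from the single row `γ₀ ≤ ((D′(L, C68)⁻¹∕(b₀Q₀(p₀)))²)²`, **`D′(L, C) := 36288000·L²·C + 2·(2C·C₂′ +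
  C₂′²) + 1`, `C₂′ := (11612160000·L² + 1331529∕4)·C²`** — the `γ₀`-row numeral of record for every odd `L > 1` — and its record-level transport `…_dL_cast` (row stated with `L`,
  family with `F.L = L`);
* §2 the record closers without the floor: the record ✓`AlphaInputsT3AC.PinnedPartsT3ACRecNestedV4Chi L` quantifies over EVERY positive tolerance `φ`, so NO new record is needed —
  instantiate `φ C := D′(L, C)⁻¹`: ★ `pinnedPartsT3ACRecSelXsV4Chi_of_nested_dL`, ★★★ `alphaInputsT3ACv4RecChi_of_pinnedPartsRecNestedV4Chi_dL : PinnedPartsT3ACRecNestedV4Chi L →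
  AlphaInputsT3ACv4RecChi L`;
* §3 the one-supplier form ★★★ `HistoryTailSelSupplier.laneRecordsV4Chi_of_thm1In8_nestedDataRows_dL` with conclusion `∀ L, Odd L → 1 < L → AlphaInputsT3ACv4RecChi L` (the text of
  LEAD's v5p10 stub `stub_laneRecordsV4Chi`), hypotheses verbatim those of ✓`laneRecordsV4Chi_of_thm1In8_nestedDataRows`.
Proofs = the originals' verbatim with the `_dL` seam closer substituted.
HONEST FRAMING.  Arithmetic bookkeeping∕re-plumbing of landed theorems; (O⁗χ) = NODE O's rows, [7] Thm 1 in the (T8) form and the crux are NOT proved — they are the displayed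
hypotheses `hT8`∕`hrows`; count-neutral helper (`--supports stmt-QuantumFields-19936`); registry and binders untouched.  YM₃ on the three-torus is rung R3 of the programme, NOT
the Clay problem; nothing here bears on d = 4, infinite volume, or a mass gap.

References: T. Bałaban, Commun. Math. Phys. 102 (1985) 255–275 [Balaban1985UV3] ((5) p.256, (7) p.257, (47) p.267, (67)–(71) p.273, Thm 2 p.272); Commun. Math. Phys. 102 (1985)
277–309 [Balaban1985Variational] (Thm 1 (6)–(8) pp.278–279, Prop 8 p.304).
-/

set_option autoImplicit false

noncomputable section

namespace Summit.QuantumFields.YangMills.Theorems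

open Literature.MathematicalPhysics.QuantumFieldTheory.Balaban1983to89
open Literature.MathematicalPhysics.QuantumFieldTheory.Balaban1983to89.T3ContinuumYM3Torus
open Literature.MathematicalPhysics.QuantumFieldTheory.Balaban1985CMP102.Setting
open Summit.QuantumFields.Balaban3D.Carriers
open Summit.QuantumFields.Balaban3D.Proofs.Primitives (AlphaConsts)
open Summit.QuantumFields.Balaban3D.Proofs.Thresholds (Q0 Q0_pos)

/-! ## §1 The seam row at every coupling of the window from one `γ₀`-row, every odd `L > 1` -/

section Seam

variable {F : T3Family} {𝔠 : AlphaConsts F.L (suGroupModel 2).N}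

/-- ★ **THE (71)_sym SEAM ROW AT EVERY `(γ, K)` OF THE RECORD'S WINDOW FROM ONE `γ₀`-ROW, EVERY ODD `L > 1`** (no floor): with `C₂′ = (11612160000·L² + 1331529∕4)·C68²` and
`D′ = 36288000·L²·C68 + 2·(2C68·C₂′ + C₂′²) + 1`, `γ₀ ≤ ((D′⁻¹/(b₀Q₀(p₀)))²)²` ⟹ `SmallFactor71OfRecT3 F 𝔠 γ hγ hγ1 K` (`windows71_of_gamma0` into ★w2-19936 g4's floor-free
`smallFactor71OfRecT3_of_windows_dL`). [cite: Balaban1985UV3, (7) p.257 and (67)–(71) p.273] -/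
theorem AlphaInputsT3AC.smallFactor71OfRecT3_of_gamma0_dL
    (hg : 𝔠.gamma0 ≤ (((36288000 * (F.L : ℝ) ^ 2 * 𝔠.C68 +
        2 * (2 * 𝔠.C68 * ((11612160000 * (F.L : ℝ) ^ 2 + 1331529 / 4) * 𝔠.C68 ^ 2) + ((11612160000 * (F.L : ℝ) ^ 2 + 1331529 / 4) * 𝔠.C68 ^ 2) ^ 2) + 1)⁻¹ /
        (𝔠.b₀ * Q0 𝔠.p₀)) ^ 2) ^ 2)
    (γ : ℝ) (hγ : 0 < γ) (hγ1 : γ ≤ (min 𝔠.gamma0 1) ^ 2) (K : ℕ) :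
    AlphaInputsT3AC.SmallFactor71OfRecT3 F 𝔠 γ hγ hγ1 K := by
  have hC68 : 0 < 𝔠.C68 := 𝔠.C68_pos
  have ha : (0 : ℝ) ≤ 36288000 * (F.L : ℝ) ^ 2 * 𝔠.C68 := by positivity
  have hc : (0 : ℝ) ≤ 2 * 𝔠.C68 * ((11612160000 * (F.L : ℝ) ^ 2 + 1331529 / 4) * 𝔠.C68 ^ 2) +
      ((11612160000 * (F.L : ℝ) ^ 2 + 1331529 / 4) * 𝔠.C68 ^ 2) ^ 2 := by positivity
  exact AlphaInputsT3AC.smallFactor71OfRecT3_of_windows_dL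
    (fun j hj => (AlphaInputsT3AC.windows71_of_gamma0 ha hc hg γ hγ hγ1 K j hj).1)
    (fun j hj => (AlphaInputsT3AC.windows71_of_gamma0 ha hc hg γ hγ hγ1 K j hj).2)

end Seam

/-- At a family of block size `L` (any odd `L > 1`): the `γ₀`-row (stated with `L`) gives the seam row at every `(γ, K)` for the transported constants `hF ▸ 𝔠`.
[cite: Balaban1985UV3, (7) p.257 and (67)–(71) p.273] -/
theorem AlphaInputsT3AC.smallFactor71OfRecT3_of_gamma0_dL_cast {L : ℕ} {𝔠 : AlphaConsts L (suGroupModel 2).N}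
    (hg : 𝔠.gamma0 ≤ (((36288000 * (L : ℝ) ^ 2 * 𝔠.C68 +
        2 * (2 * 𝔠.C68 * ((11612160000 * (L : ℝ) ^ 2 + 1331529 / 4) * 𝔠.C68 ^ 2) + ((11612160000 * (L : ℝ) ^ 2 + 1331529 / 4) * 𝔠.C68 ^ 2) ^ 2) + 1)⁻¹ /
        (𝔠.b₀ * Q0 𝔠.p₀)) ^ 2) ^ 2)
    (F : T3Family) (hF : F.L = L) :
    ∀ (γ : ℝ) (hγ : 0 < γ) (hγ1 : γ ≤ (min (hF ▸ 𝔠).gamma0 1) ^ 2) (K : ℕ), AlphaInputsT3AC.SmallFactor71OfRecT3 F (hF ▸ 𝔠) γ hγ hγ1 K := by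
  subst hF
  exact fun γ hγ hγ1 K => AlphaInputsT3AC.smallFactor71OfRecT3_of_gamma0_dL hg γ hγ hγ1 K

open Literature.MathematicalPhysics.QuantumFieldTheory.Balaban1983to89.T3PrintedMinimiserExistence (Thm1GlobalMinAt)
open Literature.MathematicalPhysics.QuantumFieldTheory.Balaban1983to89.ExpMeanLog (deltaSU)
open B7Prop2Explicit (C0 C0_pos)

/-! ## §2 The record closers at every odd `L > 1` (the numeral-free tolerance instantiated at `D′(L, C)⁻¹`) -/

/-- ★ **THE NESTED DISPLAY IMPLIES THE ONE-CURRENCY SEAM DISPLAY, every odd `L > 1`**: `PinnedPartsT3ACRecNestedV4Chi L → PinnedPartsT3ACRecSelXsV4Chi L` — the tolerance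
instantiated with the floor-free numerals `φ C := D′(L, C)⁻¹` (`smallFactor71OfRecT3_of_gamma0_dL_cast`), (O⁗χ) ⇒ (O‴χₛ) by the collar (`selXsRows_of_nestedRows_cast`).
[cite: Balaban1985UV3, (7) p.257 and (67)–(71) p.273; Balaban1985Variational, Thm 1 (8) p.279] -/
theorem AlphaInputsT3AC.pinnedPartsT3ACRecSelXsV4Chi_of_nested_dL {L : ℕ} (h : AlphaInputsT3AC.PinnedPartsT3ACRecNestedV4Chi L) :
    AlphaInputsT3AC.PinnedPartsT3ACRecSelXsV4Chi L := by
  obtain ⟨b₁, p₁, h⟩ := h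
  refine ⟨b₁, p₁, fun b₀ p₀ hb hp => ?_⟩
  obtain ⟨𝔠, a₀, a₁, h1, h2, h3, h4, h5, hA3, hA2, hB₃, hC, hCe, hCa, hM₁, hg, hT, hD⟩ := h b₀ p₀ hb hp
    (fun C => (36288000 * (L : ℝ) ^ 2 * C +
      2 * (2 * C * ((11612160000 * (L : ℝ) ^ 2 + 1331529 / 4) * C ^ 2) + ((11612160000 * (L : ℝ) ^ 2 + 1331529 / 4) * C ^ 2) ^ 2) + 1)⁻¹)
    (fun C hC => by positivity)
  exact ⟨𝔠, a₀, a₁, h1, h2, h3, h4, h5, hA3, hA2, hB₃, hC, hCe, hCa, hT, fun F hF =>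
    ⟨AlphaInputsT3AC.smallFactor71OfRecT3_of_gamma0_dL_cast hg F hF, AlphaInputsT3AC.selXsRows_of_nestedRows_cast hM₁ F hF (hD F hF)⟩⟩

/-- ★★★ **THE VERSION-4 STUB TEXT 2′χ FROM THE NESTED DISPLAY, every odd `L > 1`**: `PinnedPartsT3ACRecNestedV4Chi L → AlphaInputsT3ACv4RecChi L` — 2′χ-v4 re-cut to «(T) [7] Thm 1 +
the record sizes + collar + a `γ₀`-tolerance row + (O⁗χ) ONE nested-regular constrained minimiser selection with its χ data rows»: NO seam, NO comb letter, NO (FL), NO floor.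
[cite: Balaban1985UV3, Thm 2 p.272, (47) p.267 and (67)–(71) p.273; Balaban1985Variational, Thm 1 (8) p.279] -/
theorem alphaInputsT3ACv4RecChi_of_pinnedPartsRecNestedV4Chi_dL {L : ℕ} (h : AlphaInputsT3AC.PinnedPartsT3ACRecNestedV4Chi L) :
    AlphaInputsT3ACv4RecChi L :=
  alphaInputsT3ACv4RecChi_of_pinnedPartsRecSelXsV4Chi (AlphaInputsT3AC.pinnedPartsT3ACRecSelXsV4Chi_of_nested_dL h)

end Summit.QuantumFields.YangMills.Theorems

/-! ## §3 The one-supplier form at every odd `L > 1` (the v5p10 stub text's shape) -/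

namespace Summit.QuantumFields.YangMills.Theorems.HistoryTailSelSupplier

open MeasureTheory Set
open scoped Matrix.Norms.L2Operator
open Literature.MathematicalPhysics.QuantumFieldTheory.Balaban1983to89
open Literature.MathematicalPhysics.QuantumFieldTheory.Balaban1983to89.T3ContinuumYM3Torus
open Literature.MathematicalPhysics.QuantumFieldTheory.Balaban1983to89.T3PrintedMinimiserExistence (Thm1GlobalMinAt)
open Literature.MathematicalPhysics.QuantumFieldTheory.Balaban1983to89.T3LowerAlongMinimisersSplit (MinimisersIn8At)
open Literature.MathematicalPhysics.QuantumFieldTheory.Balaban1983to89.ExpMeanLog (deltaSU)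
open Literature.MathematicalPhysics.QuantumFieldTheory.Balaban1985CMP102.Setting
open Summit.QuantumFields.Balaban3D.Carriers
open Summit.QuantumFields.Balaban3D.Proofs.Primitives
open Summit.QuantumFields.Balaban3D.Proofs.Thresholds (Q0 Q0_pos)
open B7Prop2Explicit (C0 C0_pos)

/-- ★★★ **THE v5p10 STUB TEXT AT EVERY ODD `L > 1` ⇐ ⟨v5kC∕v5kD's `stub_thm1In8GlobalMin` TEXT⟩ ∧ (∀ odd `L > 1`, THE NESTED v4 SUPPLIER ROWS)** — `laneRecordsV4Chi_of_thm1In8_nestedDataRows`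
with the floor `5 ≤ L` REMOVED: at every odd block size a floor `B₀` and a box `(0, A₀] × (0, A₁]` on which, for every profile and every positive tolerance `φ`, the record rows
(collar, `C68`-rows, `γ₀ ≤ ((φ(C68)∕(b₀Q₀))²)²`) and, per family∕`(γ, K)`, ONE nested-regular constrained minimiser selection with its [Balaban1985UV3] Sect. B–C χ-data (O⁗χ) are
served — print's own shape: NO seam, NO numerals, NO (FL), NO floor. [cite: Balaban1985UV3, (5) p.256, (47) p.267, (67)–(71) p.273 and Thm 2 p.272; Balaban1985Variational, Thm 1 (8) p.279 and Prop 8 p.304] -/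
theorem laneRecordsV4Chi_of_thm1In8_nestedDataRows_dL
    (hT8 : ∀ L : ℕ, Odd L → 1 < L → ∃ a₀ a₁ B₃ : ℝ, 0 < a₀ ∧ 0 < a₁ ∧ 0 < B₃ ∧
      Thm1GlobalMinAt L a₀ a₁ B₃ ∧ MinimisersIn8At L a₀ a₁ B₃)
    (hrows : ∀ L : ℕ, Odd L → 1 < L → ∃ (B₀ A₀ A₁ : ℝ), 0 < A₀ ∧ 0 < A₁ ∧
      ∀ (B a₀ a₁ : ℝ), B₀ ≤ B → 1 ≤ 2 * B → 0 < a₀ → a₀ ≤ A₀ → 0 < a₁ → a₁ ≤ A₁ → B * a₁ ≤ a₀ →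
        (143 * ((((3 + 4 : ℕ) : ℝ)) ^ 2 / 4) ^ 2) * (2 * (B * a₁)) ≤ 1 / 3 →
        2 * (2 * (B * a₁)) ≤ 2 * deltaSU (Fin 2) / (((3 + 4) * L : ℕ) : ℝ) ^ 2 →
        Thm1GlobalMinAt L a₀ a₁ B →
        ∃ (b₁ p₁ : ℝ), ∀ (b₀ p₀ : ℝ), b₁ ≤ b₀ → p₁ ≤ p₀ → ∀ (φ : ℝ → ℝ), (∀ x : ℝ, 0 < x → 0 < φ x) →
          ∃ 𝔠 : AlphaConsts L (suGroupModel 2).N, 𝔠.b₀ = b₀ ∧ 𝔠.p₀ = p₀ ∧ 𝔠.B₃ = B ∧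
            4 * 𝔠.B₃ * (L : ℝ) ^ 2 * avgWindowFactor L ≤ 𝔠.C68 ∧
            Real.exp (𝔠.p₀ - 1) ≤ 3 * C0 3 * 𝔠.C68 * (𝔠.b₀ * Q0 𝔠.p₀) ∧
            (𝔠.b₀ * Q0 𝔠.p₀) * (2 * (L : ℝ) ^ 2 * avgWindowFactor L) ^ 2 ≤ 3 * C0 3 * 𝔠.C68 * a₁ ^ 2 ∧
            7 * L + 3 ≤ 𝔠.M₁ ∧
            𝔠.gamma0 ≤ ((φ 𝔠.C68 / (𝔠.b₀ * Q0 𝔠.p₀)) ^ 2) ^ 2 ∧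
            ∀ (F : T3Family) (hF : F.L = L) (γ : ℝ) (hγ : 0 < γ) (hγ1 : γ ≤ (min (hF ▸ 𝔠).gamma0 1) ^ 2) (K : ℕ),
              (∃ Ut : (k : ℕ) → GaugeField (F.P K) k (Matrix.specialUnitaryGroup (Fin 2) ℂ) →
                  GaugeField (F.P K) 0 (Matrix.specialUnitaryGroup (Fin 2) ℂ),
                AlphaInputsT3AC.TrivMinimiserRowsT3 F (hF ▸ 𝔠) γ hγ hγ1 a₀ a₁ K Ut) →
              ∃ Ut : (k : ℕ) → GaugeField (F.P K) k (Matrix.specialUnitaryGroup (Fin 2) ℂ) →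
                  GaugeField (F.P K) 0 (Matrix.specialUnitaryGroup (Fin 2) ℂ),
                AlphaInputsT3AC.TrivMinimiserRowsT3 F (hF ▸ 𝔠) γ hγ hγ1 a₀ a₁ K Ut ∧
                  AlphaInputsT3AC.DataRowsT3NestedChiSel F (hF ▸ 𝔠) γ hγ hγ1 K Ut) :
    ∀ L : ℕ, Odd L → 1 < L → AlphaInputsT3ACv4RecChi L := by
  intro L hLo hL
  obtain ⟨a₀, a₁, B₃, ha₀, ha₁, hB₃, hT, -⟩ := hT8 L hLo hL
  obtain ⟨B₀, A₀, A₁, hA₀, hA₁, h⟩ := hrows L hLo hL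
  exact alphaInputsT3ACv4RecChi_of_pinnedPartsRecNestedV4Chi_dL
    (pinnedPartsT3ACRecNestedV4Chi_of_thm1_rows hL ⟨a₀, a₁, B₃, ha₀, ha₁, hB₃, hT⟩ hA₀ hA₁ h)

end Summit.QuantumFields.YangMills.Theorems.HistoryTailSelSupplier

end
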